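import Summits.CriticalPhenomena.SAWScalingLimit.Theses.SAWDefectDecoherence
import Literature.Probability.RandomPlanarGeometry.HexParafermionProofs
import Summits.CriticalPhenomena.SAWScalingLimit.Theorems.BoundaryClosureR.Negative.NormaliserPin
import Summits.CriticalPhenomena.SAWScalingLimit.Theorems.BoundaryClosureR.Negative.RootPin

/-!
# Disproof of `BoundaryClosureR` (stmt-CriticalPhenomena-14004) — the standing adversary's work file

Crux (route SAWDefectDecoherence, r4):
`BoundaryClosureR := DefectDecoherence → MassRatio → HexObservableLimitR` — the boundary Riemann–Hilbert
half of Duminil-Copin–Smirnov's Conjecture 2 GIVEN the route's two exponent cruxes, over the REPAIRED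
target `HexObservableLimitR` (stmt-14003: root `a` and normaliser `b` both pinned conformally — flat
half-plane piece + exact half-lattice inside `ball (pt i) ρ`).

## Findings (cycle 1, 2026-08-16; refuter-cdisprove-stmt-CriticalPhenomena-14004-0)

* (F0, §0) LOGIC.  `¬BoundaryClosureR ↔ DefectDecoherence ∧ MassRatio ∧ ¬HexObservableLimitR`
  (`not_crux_iff`).  A kill of the crux needs PROOFS of both exponent cruxes (open problems, numerically
  standing: θ_eff ≈ 1.15 > 3/4 at R ≤ 8 for DD, MR resists its own cdisprove seat) AND a refutation of
  the target; `¬DD` or `¬MR` would close the crux vacuously (`crux_of_not_defectDecoherence`,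
  `crux_of_not_massRatio`) — the wrong reason, flagged, not pursued.  So the only honest attack surface
  is the target `HexObservableLimitR` itself (a refutation of which re-breaks the route and makes the
  crux equivalent to `¬(DD ∧ MR)`: `not_target_iff_of_cruxes`).
* (F1) NO KILL.  The repaired target resists: its frame was re-audited symbol by symbol (rows `v.1 1` are
  the horizontal zigzag rows of `hexCenter`, the pinned boundary mid-edges are the vertical edges of ONE
  lattice class, the phase of `F(e)/F(b_δ)` matches the continuous branch of `log Φ'` in both
  configurations of `a, b` on horizontal floors, overlapping pin-balls force equal floor heights (else the
  premise is vacuous, not false), `Φ` is unique up to `λ > 0` and `L` up to `2πiℤ`, so the predicted limit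
  is well defined).  Physically the statement is DCS Conjecture 2 averaged against bulk test functions;
  collar decorations away from the two rigid balls cannot force a channel on the walks (restriction
  heuristics), so no second relocation witness exists.  Literature: no counterexample to Conj. 2 in print
  (Kennedy–Lawler lattice effects concern boundary classes, which the statement fixes).
* (F2, §1) LOAD-BEARING HYPOTHESES OF THE TARGET — both lattice pins are necessary (checked theorems,
  landed as `Theorems/BoundaryClosureR/Negative/{ShiftedHalfDisc,PeelEnd,EndCorridor,NormaliserPin,RootPin}.lean`):
  - `target_false_without_normaliserPin` (NEW witness): drop the exact half-lattice at `b` but KEEP the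
    flat boundary there and the root's pin ⇒ FALSE.  A dead-end corridor ENDING at `b_δ` (root `bEdge`
    pinned at `0`, body normalised at its junction edge `→ 1/2` versus body ∪ row-0 corridor normalised at
    the tip `→ 3/4` on the half-disc) leaves every bulk value of `F_δ` unchanged (no SAW passes a dead
    end) and multiplies `F_δ(b_δ)` by `κ`, `‖κ‖ = x_c^{2T-2X} → 0`; the statement would make the body's
    normalised averages converge both to `c∫ψ e^{(5/8)(M-M_b)}` and to `0`.  READING: "∂Ω smooth near b
    and b_δ → b" (all that DCS Conj. 2 asks verbatim) does NOT pin the normalisation; any proof must use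
    the exact zigzag class at `b` (in line two-root-quotient: `FlatTrace`, `FlatLocality`).
  - `target_false_without_rootPin`: drop the exact half-lattice at the ROOT but keep the flat boundary
    there ⇒ FALSE (the corridor-at-the-root witness of the landed stmt-5420 refutation satisfies the extra
    flatness premise).  READING: the repair 5420 → 14003 needed the LATTICE pin, flatness alone is void.
  - Both weakened statements imply the target (`target_of_withoutNormaliserPin`, `target_of_withoutRootPin`),
    so these are genuine hypothesis-deletions of `HexObservableLimitR`.
* (F3, §2) HYPOTHESES OF THE CRUX ITSELF.  `DefectDecoherence`, `MassRatio` are PROOF DEVICES, not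
  logical necessities: `BoundaryClosureR`-without-DD is `MassRatio → X`, -without-MR is
  `DefectDecoherence → X`, and both follow from `X` alone (`cruxWithout_of_target`), which is believed
  true; a `_false_without_` theorem is therefore impossible here short of refuting Conj. 2.  What the
  provers should read instead: the crux still carries, BEYOND DD+MR, (i) local `L¹`/Harnack control of
  `F_δ/F_δ(b_δ)` (compactness of the weak limits), (ii) the rough-collar transfer of the two-valued
  boundary argument, (iii) the order-`5/4` root singularity, (iv) universality of the boundary-layer
  constant at `b` — (iv) is exactly where (F2) bites: the constant is a property of the rigid zigzag class.
* (F4, §3) MUTATION — redundant hypotheses of the target frame: `Nonempty (HexMidEdgeSAW (Λ δ) (a δ) (b δ))`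
  follows from `Preconnected` + the two boundary mid-edges being distinct (`nonempty_saw_of_preconnected`;
  note the adjacency of the second edge is not even used); distinctness holds eventually since
  `δ·mid(a δ) → pt 0 ≠ pt 1 ← δ·mid(b δ)`.  `Preconnected` itself is nearly redundant for the conclusion
  (exhaustion of a compact connector forces the root's component to contain every vertex under
  `tsupport ψ` and the pinned ball at `b`; stray collar components contribute `F = 0`) — remark only.
* (F5, §4) STUB AUDIT of the planner's line `Cruxes/BoundaryClosure/Lines/two-root-quotient.lean`
  (7 stubs) against the conjectural continuum picture `g_x = c (Φ_x'/Φ_x'(b))^{5/8}`: all CONSISTENT —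
  `RootRatioLaw`: `1 - Φ/t` stays in one open half-plane for real `t ≠ 0`, so the principal power
  `(1 - Φ/t)^{-5/4}` IS the continuous branch normalised to `1` at `b` (no hidden `e^{±5πi/4}`);
  `FlatLocality`: with the boundary two-point kernel `H_D(x,b) = (Φ_x'(b)/R_x)^{5/8}` (`R_x` the residue
  of `Φ_x` at `x`) one gets `‖κ_x‖/‖κ_{x'}‖ = μ` as stated; `FlatTrace`: `Φ_x' > 0` along the flat piece
  `I` (ccw monotonicity), phase constant on `I` only when the root's ball misses the normaliser's (the
  stub's disjointness clause is necessary: crossing the root flips the phase by `e^{-5πi/4}`);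
  `TwoRootArcConstancy`: `W(a → e) = Δτ_ccw(a, e) - π` by the discrete Umlaufsatz, whence the two-valued
  difference; `CupLimits`/`Identification`: exact order `5/4` and non-zero flat boundary values match
  `(Φ')^{5/8}` with a simple pole of `Φ` at the root.  No stub is cheaply false; the load-bearing open
  ones are `stub_cupLimits` (compactness/univalence from DD+MR) and `stub_ratioContinuity` (two-root
  boundary Harnack for SAW, open even heuristically at lattice-scale targets).
* (F6, §5) NEAR-MISSES / NEXT REGIMES (no theorem claimed): (a) a MESOSCOPIC dead-end fjord at `b` of
  Euclidean length `→ 0` but `≫ 1` lattice units already kills the b-normalisation — same proof with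
  `corrLen δ → ∞`, `δ·corrLen δ → 0`; recorded to warn against repairs of the form "Λ_δ canonical outside a
  shrinking neighbourhood of b"; (b) armchair (vertical) flat pieces or a `b` on a zigzag-exposed edge
  change the boundary-layer constant (Kennedy–Lawler): the universal `c` of the target is tied to the
  vertical-edge class — consistent as stated, but any `ObservableToSLER` bootstrap to rough `b` must
  divide it out; (c) pointwise (un-averaged) Conj. 2 at mid-edges of the three orientations: leading
  order orientation-free by Poisson summation of the lifted final-direction law, aliases at `σ - 2`
  suppressed by a power of `δ` — not attackable by finite computation.

Targets (`payload.targets` / stuck stubs): none registered yet (no lead, no PICKED line); §4 pre-audits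
the seven stubs of the only planned line.

§6 (drefute seat, 2026-08-16, line `pick-half-plane` PICKED): stub-set attack of `Lines/pick_half_plane.lean` (lead r2) —
(F7) `stub_halfPlaneInputs` is STUB-FALSE through `BoundaryHalfPlaneBounds` (i′) on curled carriers (`W(a→b) = ±3π`), repair C′;
(F8) the other six survive; (F9) lattice facts for the lead.  See §6.
-/

noncomputable section

open scoped BigOperators Topology
open Filter Set
open Literature.Probability.LatticeModels Literature.Probability.RandomPlanarGeometry
open Literature.Probability.RandomPlanarGeometry.SAW
open Summit.CriticalPhenomena.SAWScalingLimit.Theses.SAWDefectDecoherence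

namespace Summit.CriticalPhenomena.SAWScalingLimit.Cruxes.BoundaryClosureR.Disproof

/-! ## §0 Logic of the conditional crux -/

/-- The shape of a kill: `¬BoundaryClosureR` is `DD ∧ MR ∧ ¬X`. [folklore] -/
theorem not_crux_iff :
    ¬ BoundaryClosureR ↔ DefectDecoherence ∧ MassRatio ∧ ¬ HexObservableLimitR := by
  rw [BoundaryClosureR, Classical.not_imp, Classical.not_imp]

/-- The target alone proves the crux (the crux is weaker than its conclusion). [folklore] -/
theorem crux_of_target (hX : HexObservableLimitR) : BoundaryClosureR := fun _ _ => hX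

/-- Ex-falso channel 1 (the WRONG reason, flagged): a refutation of `DefectDecoherence` would close the
crux vacuously. [folklore] -/
theorem crux_of_not_defectDecoherence (h : ¬ DefectDecoherence) : BoundaryClosureR := fun hDD => absurd hDD h

/-- Ex-falso channel 2 (the WRONG reason, flagged): a refutation of `MassRatio` would close the crux
vacuously. [folklore] -/
theorem crux_of_not_massRatio (h : ¬ MassRatio) : BoundaryClosureR := fun _ hMR => absurd hMR h

/-- Given the two exponent cruxes, the crux and its target are equivalent: a refutation of the target is
then a refutation of the crux, and conversely. [folklore] -/
theorem not_target_iff_of_cruxes (hDD : DefectDecoherence) (hMR : MassRatio) :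
    ¬ HexObservableLimitR ↔ ¬ BoundaryClosureR :=
  ⟨fun hX hBC => hX (hBC hDD hMR), fun hBC hX => hBC (crux_of_target hX)⟩

/-! ## §1 Load-bearing hypotheses of the TARGET `HexObservableLimitR`

The two weakened targets below are written as literal hypothesis lists (one row threshold `m : ℝ → ℤ`
and the lattice pin at ONE marked point only; flatness kept at both), verbatim the propositions refuted
in `Theorems/BoundaryClosureR/Negative/{NormaliserPin,RootPin}.lean`. -/

/-- `HexObservableLimitR` with the exact half-lattice required at the ROOT `pt 0` only (the lattice pin
at the normalisation point `pt 1` dropped; flatness of `∂Ω` kept at both marked points). -/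
def TargetWithoutNormaliserPin : Prop :=
  ∃ c : ℂ, c ≠ 0 ∧
    ∀ (D : Literature.Probability.RandomPlanarGeometry.DobrushinDomain) (ρ : ℝ)
      (Λ : ℝ → Finset Literature.Probability.LatticeModels.HexVertex) (m : ℝ → ℤ)
      (a b : ℝ → Sym2 Literature.Probability.LatticeModels.HexVertex)
      (Φ : Literature.Probability.RandomPlanarGeometry.ConformalEquiv D.carrier UpperHalfPlane.upperHalfPlaneSet)
      (L : ℂ → ℂ) (Lb : ℂ) (ψ : ℂ → ℂ),
      let F : ℝ → Sym2 Literature.Probability.LatticeModels.HexVertex → ℂ := fun δ z =>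
        Literature.Probability.RandomPlanarGeometry.SAW.hexParafermionicObservable (Λ δ) (a δ)
          Literature.Probability.RandomPlanarGeometry.SAW.hexCriticalFugacity (5 / 8) z
      0 < ρ → (∀ i : Fin 2, D.carrier ∩ Metric.ball (D.pt i) ρ = {z : ℂ | (D.pt i).im < z.im} ∩ Metric.ball (D.pt i) ρ) →
      (∀ᶠ δ : ℝ in nhdsWithin 0 (Set.Ioi 0),
        Literature.Probability.RandomPlanarGeometry.SAW.hexDomainSimplyConnected (Λ δ) ∧
        a δ ∈ Literature.Probability.RandomPlanarGeometry.SAW.hexDomainBoundary (Λ δ) ∧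
        b δ ∈ Literature.Probability.RandomPlanarGeometry.SAW.hexDomainBoundary (Λ δ) ∧
        Nonempty (Literature.Probability.RandomPlanarGeometry.SAW.HexMidEdgeSAW (Λ δ) (a δ) (b δ)) ∧
        (Literature.Probability.LatticeModels.hexGraph.induce ((Λ δ : Finset
          Literature.Probability.LatticeModels.HexVertex) : Set
          Literature.Probability.LatticeModels.HexVertex)).Preconnected ∧
        (∀ v ∈ Λ δ, (δ : ℂ) * Literature.Probability.LatticeModels.hexCenter v ∈ D.carrier) ∧
        (∀ v : Literature.Probability.LatticeModels.HexVertex, (δ : ℂ) *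
          Literature.Probability.LatticeModels.hexCenter v ∈ Metric.ball (D.pt 0) ρ → (v ∈ Λ δ ↔ m δ ≤ v.1 1))) →
      (∀ K : Set ℂ, IsCompact K → K ⊆ D.carrier → ∀ᶠ δ : ℝ in nhdsWithin 0 (Set.Ioi 0), ∀ v :
        Literature.Probability.LatticeModels.HexVertex, (δ : ℂ) *
        Literature.Probability.LatticeModels.hexCenter v ∈ K → v ∈ Λ δ) →
      Filter.Tendsto (fun δ : ℝ => (δ : ℂ) * Literature.Probability.RandomPlanarGeometry.SAW.hexMidpoint (a δ))
        (nhdsWithin 0 (Set.Ioi 0)) (nhds (D.pt 0)) →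
      Filter.Tendsto (fun δ : ℝ => (δ : ℂ) * Literature.Probability.RandomPlanarGeometry.SAW.hexMidpoint (b δ))
        (nhdsWithin 0 (Set.Ioi 0)) (nhds (D.pt 1)) →
      Filter.Tendsto (fun x => ‖Φ x‖) (nhdsWithin (D.pt 0) D.carrier) Filter.atTop →
      Φ.HasBoundaryValue (D.pt 1) 0 → ContinuousOn L D.carrier → (∀ z ∈ D.carrier, Complex.exp (L z) = deriv Φ z) →
      Filter.Tendsto L (nhdsWithin (D.pt 1) D.carrier) (nhds Lb) → Continuous ψ → HasCompactSupport ψ →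
      tsupport ψ ⊆ D.carrier →
      Filter.Tendsto (fun δ : ℝ => (δ : ℂ) ^ 2 * (∑ᶠ e ∈
        Literature.Probability.RandomPlanarGeometry.SAW.hexDomainMidEdges (Λ δ), ψ ((δ : ℂ) *
        Literature.Probability.RandomPlanarGeometry.SAW.hexMidpoint e) * F δ e) / F δ (b δ))
        (nhdsWithin 0 (Set.Ioi 0)) (nhds (c * ∫ z, ψ z * Complex.exp ((5 / 8 : ℂ) * (L z - Lb))))

/-- `HexObservableLimitR` with the exact half-lattice required at the NORMALISATION POINT `pt 1` only
(the lattice pin at the root `pt 0` dropped; flatness of `∂Ω` kept at both marked points). -/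
def TargetWithoutRootPin : Prop :=
  ∃ c : ℂ, c ≠ 0 ∧
    ∀ (D : Literature.Probability.RandomPlanarGeometry.DobrushinDomain) (ρ : ℝ)
      (Λ : ℝ → Finset Literature.Probability.LatticeModels.HexVertex) (m : ℝ → ℤ)
      (a b : ℝ → Sym2 Literature.Probability.LatticeModels.HexVertex)
      (Φ : Literature.Probability.RandomPlanarGeometry.ConformalEquiv D.carrier UpperHalfPlane.upperHalfPlaneSet)
      (L : ℂ → ℂ) (Lb : ℂ) (ψ : ℂ → ℂ),
      let F : ℝ → Sym2 Literature.Probability.LatticeModels.HexVertex → ℂ := fun δ z =>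
        Literature.Probability.RandomPlanarGeometry.SAW.hexParafermionicObservable (Λ δ) (a δ)
          Literature.Probability.RandomPlanarGeometry.SAW.hexCriticalFugacity (5 / 8) z
      0 < ρ → (∀ i : Fin 2, D.carrier ∩ Metric.ball (D.pt i) ρ = {z : ℂ | (D.pt i).im < z.im} ∩ Metric.ball (D.pt i) ρ) →
      (∀ᶠ δ : ℝ in nhdsWithin 0 (Set.Ioi 0),
        Literature.Probability.RandomPlanarGeometry.SAW.hexDomainSimplyConnected (Λ δ) ∧
        a δ ∈ Literature.Probability.RandomPlanarGeometry.SAW.hexDomainBoundary (Λ δ) ∧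
        b δ ∈ Literature.Probability.RandomPlanarGeometry.SAW.hexDomainBoundary (Λ δ) ∧
        Nonempty (Literature.Probability.RandomPlanarGeometry.SAW.HexMidEdgeSAW (Λ δ) (a δ) (b δ)) ∧
        (Literature.Probability.LatticeModels.hexGraph.induce ((Λ δ : Finset
          Literature.Probability.LatticeModels.HexVertex) : Set
          Literature.Probability.LatticeModels.HexVertex)).Preconnected ∧
        (∀ v ∈ Λ δ, (δ : ℂ) * Literature.Probability.LatticeModels.hexCenter v ∈ D.carrier) ∧
        (∀ v : Literature.Probability.LatticeModels.HexVertex, (δ : ℂ) *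
          Literature.Probability.LatticeModels.hexCenter v ∈ Metric.ball (D.pt 1) ρ → (v ∈ Λ δ ↔ m δ ≤ v.1 1))) →
      (∀ K : Set ℂ, IsCompact K → K ⊆ D.carrier → ∀ᶠ δ : ℝ in nhdsWithin 0 (Set.Ioi 0), ∀ v :
        Literature.Probability.LatticeModels.HexVertex, (δ : ℂ) *
        Literature.Probability.LatticeModels.hexCenter v ∈ K → v ∈ Λ δ) →
      Filter.Tendsto (fun δ : ℝ => (δ : ℂ) * Literature.Probability.RandomPlanarGeometry.SAW.hexMidpoint (a δ))
        (nhdsWithin 0 (Set.Ioi 0)) (nhds (D.pt 0)) →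
      Filter.Tendsto (fun δ : ℝ => (δ : ℂ) * Literature.Probability.RandomPlanarGeometry.SAW.hexMidpoint (b δ))
        (nhdsWithin 0 (Set.Ioi 0)) (nhds (D.pt 1)) →
      Filter.Tendsto (fun x => ‖Φ x‖) (nhdsWithin (D.pt 0) D.carrier) Filter.atTop →
      Φ.HasBoundaryValue (D.pt 1) 0 → ContinuousOn L D.carrier → (∀ z ∈ D.carrier, Complex.exp (L z) = deriv Φ z) →
      Filter.Tendsto L (nhdsWithin (D.pt 1) D.carrier) (nhds Lb) → Continuous ψ → HasCompactSupport ψ →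
      tsupport ψ ⊆ D.carrier →
      Filter.Tendsto (fun δ : ℝ => (δ : ℂ) ^ 2 * (∑ᶠ e ∈
        Literature.Probability.RandomPlanarGeometry.SAW.hexDomainMidEdges (Λ δ), ψ ((δ : ℂ) *
        Literature.Probability.RandomPlanarGeometry.SAW.hexMidpoint e) * F δ e) / F δ (b δ))
        (nhdsWithin 0 (Set.Ioi 0)) (nhds (c * ∫ z, ψ z * Complex.exp ((5 / 8 : ℂ) * (L z - Lb))))

/-- The normaliser-unpinned statement is a genuine hypothesis-deletion of the target: it implies
`HexObservableLimitR` (instantiate the single threshold with the root's `m 0`). [folklore] -/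
theorem target_of_withoutNormaliserPin (h : TargetWithoutNormaliserPin) : HexObservableLimitR := by
  obtain ⟨c, hc, H⟩ := h
  refine ⟨c, hc, ?_⟩
  intro D ρ Λ m a b Φ L Lb ψ F hρ hflat hadm hexh ha hb hΦ hΦb hL hexpL hLb hψc hψK hψD
  refine H D ρ Λ (m 0) a b Φ L Lb ψ hρ hflat ?_ hexh ha hb hΦ hΦb hL hexpL hLb hψc hψK hψD
  filter_upwards [hadm] with δ hδ
  exact ⟨hδ.1, hδ.2.1, hδ.2.2.1, hδ.2.2.2.1, hδ.2.2.2.2.1, hδ.2.2.2.2.2.1, hδ.2.2.2.2.2.2 0⟩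

/-- The root-unpinned statement is a genuine hypothesis-deletion of the target: it implies
`HexObservableLimitR` (instantiate the single threshold with the normaliser's `m 1`). [folklore] -/
theorem target_of_withoutRootPin (h : TargetWithoutRootPin) : HexObservableLimitR := by
  obtain ⟨c, hc, H⟩ := h
  refine ⟨c, hc, ?_⟩
  intro D ρ Λ m a b Φ L Lb ψ F hρ hflat hadm hexh ha hb hΦ hΦb hL hexpL hLb hψc hψK hψD
  refine H D ρ Λ (m 1) a b Φ L Lb ψ hρ hflat ?_ hexh ha hb hΦ hΦb hL hexpL hLb hψc hψK hψD
  filter_upwards [hadm] with δ hδ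
  exact ⟨hδ.1, hδ.2.1, hδ.2.2.1, hδ.2.2.2.1, hδ.2.2.2.2.1, hδ.2.2.2.2.2.1, hδ.2.2.2.2.2.2 1⟩

/-- **LOAD-BEARING (normalisation side, NEW dead-end corridor witness)**: the lattice pin at `b` cannot
be dropped from `HexObservableLimitR` — any proof of the target, hence of `BoundaryClosureR`, must use
the exact half-lattice (the rigid vertical-edge class) at the normalisation point, not only a flat `∂Ω`
there and `b_δ → b`.  Proof: `BoundaryClosureR.Negative.not_hexObservableLimit_without_normaliserPin`.
[folklore] -/
theorem target_false_without_normaliserPin : ¬ TargetWithoutNormaliserPin :=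
  Summit.CriticalPhenomena.SAWScalingLimit.Theorems.BoundaryClosureR.Negative.not_hexObservableLimit_without_normaliserPin

/-- **LOAD-BEARING (root side)**: the lattice pin at the root cannot be dropped from
`HexObservableLimitR` either, even keeping the flat boundary there (corridor at the root, the stmt-5420
witness inside the repaired frame).  Proof: `BoundaryClosureR.Negative.not_hexObservableLimit_without_rootPin`.
[folklore] -/
theorem target_false_without_rootPin : ¬ TargetWithoutRootPin :=
  Summit.CriticalPhenomena.SAWScalingLimit.Theorems.BoundaryClosureR.Negative.not_hexObservableLimit_without_rootPin

/-! ## §2 Hypotheses of the crux itself: proof devices, not necessities -/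

/-- The crux with `DefectDecoherence` dropped. -/
def CruxWithoutDefectDecoherence : Prop := MassRatio → HexObservableLimitR

/-- The crux with `MassRatio` dropped. -/
def CruxWithoutMassRatio : Prop := DefectDecoherence → HexObservableLimitR

/-- Both hypothesis-deletions of the crux follow from the target alone, which is DCS Conjecture 2
(believed true): no `_false_without_` theorem is available on the crux side — the exponent cruxes are
the route's PROOF DEVICES (they feed `DecoherenceSynthesis` ⇒ weak `∂̄`-closure), not provably necessary
hypotheses. [folklore] -/
theorem cruxWithout_of_target (hX : HexObservableLimitR) :
    CruxWithoutDefectDecoherence ∧ CruxWithoutMassRatio :=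
  ⟨fun _ => hX, fun _ => hX⟩

/-- Conversely each deletion implies the crux (monotonicity), so proving either deletion is at least as
hard as the crux. [folklore] -/
theorem crux_of_cruxWithout (h : CruxWithoutDefectDecoherence ∨ CruxWithoutMassRatio) : BoundaryClosureR :=
  fun hDD hMR => h.elim (fun h => h hMR) (fun h => h hDD)

/-! ## §3 Mutation: a redundant hypothesis of the target frame -/

/-- **The `Nonempty SAW` hypothesis is redundant**: in a connected domain any two DISTINCT boundary
mid-edges `{u, w}`, `{u', w'}` (`u, u' ∉ Λ ∋ w, w'`) are joined by a self-avoiding walk — take a simple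
path `w ⇝ w'` of the induced graph; its edges have both ends in `Λ`, so they avoid the two boundary
mid-edges.  (The adjacency `u' ∼ w'` is not even needed.)  In `HexObservableLimitR`, `MassRatio`,
`ConjugateClassNegligible` the clause `Nonempty (HexMidEdgeSAW (Λ δ) (a δ) (b δ))` therefore follows from
`Preconnected` and `a δ ≠ b δ`, which holds eventually because `δ·mid(a δ) → pt 0 ≠ pt 1 ← δ·mid(b δ)`.
Information for planner/provers; harmless as stated. [folklore] -/
theorem nonempty_saw_of_preconnected {Λ : Finset HexVertex}
    (hconn : (hexGraph.induce ((Λ : Finset HexVertex) : Set HexVertex)).Preconnected)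
    {u w u' w' : HexVertex} (huw : hexGraph.Adj u w) (hu : u ∉ Λ) (hw : w ∈ Λ)
    (hu' : u' ∉ Λ) (hw' : w' ∈ Λ) (hab : s(u, w) ≠ s(u', w')) :
    Nonempty (HexMidEdgeSAW Λ s(u, w) s(u', w')) := by
  classical
  obtain ⟨p⟩ := hconn ⟨w, hw⟩ ⟨w', hw'⟩
  set q := p.toPath with hq
  set L : List HexVertex := q.1.support.map Subtype.val with hL
  have hLΛ : ∀ v ∈ L, v ∈ Λ := by
    intro v hv
    rw [hL, List.mem_map] at hv
    obtain ⟨x, -, rfl⟩ := hv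
    exact x.2
  have hLnd : L.Nodup := (q.2.support_nodup).map Subtype.val_injective
  have hLch : L.IsChain hexGraph.Adj := by
    rw [hL, List.isChain_map]
    exact (SimpleGraph.Walk.isChain_adj_support _).imp fun a b h => by simpa using h
  have hLcons : L = w :: (q.1.support.tail.map Subtype.val) := by
    rw [hL, ← SimpleGraph.Walk.cons_tail_support]; rfl
  have hLne : L ≠ [] := by rw [hLcons]; exact List.cons_ne_nil _ _
  have hhead : L.head? = some w := by rw [hLcons]; rfl
  have hlast : L.getLast? = some w' := by
    rw [hL, List.getLast?_map, List.getLast?_eq_some_getLast (SimpleGraph.Walk.support_ne_nil _),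
      SimpleGraph.Walk.getLast_support]
    rfl
  have hmem : ∀ e ∈ List.zipWith (fun a b => s(a, b)) L L.tail, ∀ c ∈ e, c ∈ Λ := fun e he c hc =>
    hLΛ c (forall_mem_of_mem_edges _ e he c hc)
  have haL : s(u, w) ∉ List.zipWith (fun a b => s(a, b)) L L.tail := fun h =>
    hu (hmem _ h u (Sym2.mem_mk_left _ _))
  have hbL : s(u', w') ∉ List.zipWith (fun a b => s(a, b)) L L.tail := fun h =>
    hu' (hmem _ h u' (Sym2.mem_mk_left _ _))
  refine ⟨{ verts := L
            subset := hLΛ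
            nodup := hLnd
            isChain := hLch
            head_mem := fun v hv => ?_
            getLast_mem := fun v hv => ?_
            eq_of_nil := fun h => (hLne h).elim
            edges_nodup := fun _ => ?_
            fst_mem := ⟨(SimpleGraph.mem_edgeSet hexGraph).2 huw, w, Sym2.mem_mk_right _ _, hw⟩ }⟩
  · rw [hhead, Option.some_inj] at hv; subst hv; exact Sym2.mem_mk_right _ _
  · rw [hlast, Option.some_inj] at hv; subst hv; exact Sym2.mem_mk_right _ _
  · refine List.nodup_append.2 ⟨List.nodup_cons.2 ⟨haL, edges_nodup hLnd⟩, List.nodup_singleton _, ?_⟩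
    intro e he f hf
    rw [List.mem_singleton] at hf
    subst hf
    rcases List.mem_cons.1 he with rfl | he
    · exact hab
    · rintro rfl; exact hbL he

/-! ## §4 Stub audit of line `two-root-quotient` (comments only; see the module docstring (F5))

Consistency computations kept here for the lead (all with `g_x := c (Φ_x'/Φ_x'(b))^{5/8}`, `Φ_x : Ω → ℍ`,
`x ↦ ∞`, `b ↦ 0`, `Φ_x = t_x Φ/(t_x - Φ)` for `Φ = Φ_{pt 0}`, `t_x = Φ(x)`):
* `RootRatioLaw`: `Φ_x' = Φ'/(1 - Φ/t)²`, `Φ_x'(b) = Φ'(b)` ⇒ `g_x/g = (1 - Φ/t)^{-5/4}`; for `t > 0`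
  (`t < 0`) the factor `1 - Φ/t` ranges in the open lower (upper) half-plane, so `Complex.cpow` with the
  principal logarithm is continuous on `Ω` and equals `1` at `b` — it IS the branch singled out by the
  weak limits.  Sign/branch as stated: correct.
* `FlatLocality`: `κ_x = lim g_x (z - x)^{5/4} = c R_x^{5/8}/Φ_x'(b)^{5/8}` (phase aside), and
  `Z_x(b_δ) ≈ A² δ^{5/4} (Φ_x'(b)/R_x)^{5/8}` (same lattice class `A` at every pinned flat root), so
  `μ = lim Z_{x'}(b_δ)/Z_x(b_δ) = ‖κ_x‖/‖κ_{x'}‖`: consistent.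
* `FlatTrace` (ii): `Z_x(ey_δ)/Z_x(b_δ) → (Φ_x'(y)/Φ_x'(b))^{5/8} = ‖g_x(y)‖/‖g_x(b)‖` with `g_x(b) = c =: K`;
  (iii) the phase of `g_x` along `I` is constant iff `I` does not contain `x` (crossing the simple pole
  of `Φ_x` adds `-2πi` to the continuous `log Φ_x'`, i.e. the factor `e^{-5πi/4}`): the disjointness
  clause is necessary and sufficient.
* `TwoRootArcConstancy`: with `τ` the ccw tangent angle of `∂Ω_δ`, every SAW `a → e` between boundary
  mid-edges has `W = Δτ_ccw(a,e) - π` (Umlaufsatz; `R(Λ)` is a Jordan polygon because `Λ` is connected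
  with connected complement — non-consecutive `Λ`-sectors at a lattice vertex would pinch a `Λᶜ`-sector
  off infinity), so `W_a(e) - W_{a'}(e) ∈ {Δτ(a,a'), Δτ(a,a') - 2π}`: exactly two values, difference
  over `e, e'` in `{0, ±2π}` as stated.
-/

/-! ## §5 Near-misses and next regimes (no theorem claimed; see (F6)) -/

/-! ## §6 Line `pick-half-plane` — stub-set attack (drefute seat `refuter-drefute-stmt-CriticalPhenomena-14004-0`, 2026-08-16)

`-- Targets` / `-- Line pick-half-plane`: the registered stubs of `Cruxes/BoundaryClosureR/Lines/pick_half_plane.lean`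
(lead reshape r2: `stub_potentialExistence`, `stub_boundaryExactness`, `stub_halfPlaneInputs = HexHullStrict ∧
BoundaryHalfPlaneBounds`, `stub_gateMassLaws`, `stub_localL1Bound`, `stub_pickEngine`, `stub_identification`) and the r1
statements they derive (`HalfPlaneBounds`, `InteriorLimits`, `PickCupLimits`, `Identification`).  Evidence files on the item:
`halfPlaneInputs.md` (the kill), `survivors.md` (briefing).  Tools: paper audit of every quantifier + an exact enumerator in the
tree's coordinates (DCS Lemma-1 residual ≤ 1e-15, closure `Σ_{e≠a} e^{i(3/8)W_e}Z(e) = 1`).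

* (F7) **STUB-FALSE: `stub_halfPlaneInputs`, through its conjunct `BoundaryHalfPlaneBounds` (i′)** ("one `M` with `Re h_δ ≥ −M` at
  ALL non-interior sites of `Λ_δ`", needed verbatim by the lead's minimum principle `halfPlaneBounds_of`).  Exact boundary-step law
  (from (E2) + rigidity, `W_b ≡ π (2π)`): crossing the 𝕋-edge dual to a boundary edge `e ≠ a` counter-clockwise changes `Re h_δ` by
  `T′·sin((3/8)(W_e − W_b))·Z_δ(e)`, crossing the root by `T′·sin((5/8)W_b)`, `T′ = (ℓ/2)δ/Z_δ(b_δ) → ∞`; with (E4) (`W = ±π` on the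
  root's west/east arms) and `W_b = π + 2πn` the root's own boundary sites carry `Re h_δ/T′ = sin(5πn/4)·S_W + O(1/T′)` (west) and
  `… + sin(5π/8 + 5πn/4)` (east), `S_W ≥ x_c³` the west-arm arrival mass.  Benign exactly for `n ∈ {0, −1, 2, −3} (mod 8)` — the two
  flat configurations `W_b = ±π` of every census; FALSE for `n = 1` (`W_b = 3π`: coefficients `−sin(π/4)·S_W` and `−sin(π/4)S_W − sin(π/8)`,
  lemmas `westArmStep_coeff_neg_class_three_pi`, `rootStep_coeff_neg_class_three_pi` below), `n = −2, 3, ±4`.  Class `n = 1` is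
  ADMISSIBLE: a snail-shaped Jordan carrier (thick arc travelling east at the gate, one clockwise curl, travelling east again at the
  root piece; both flat pieces with the carrier above, exact half-lattices) has `τ_ccw(b→a) = −2π`, `W(a→b) = 3π`; along its clockwise
  arc from the gate (`Re h_δ(s_b) = 0` exactly) every step is `≤ 0` and the west-arm steps are `< 0` with O(1) mass, so
  `Re h_δ(s_a⁻) ≤ −(√2/2)x_c³·T′ → −∞`.  Enumeration (44-face spiral corridor): `W(a→b)/π = 3.000000`, `Re h(root sites) = −0.105T′,
  −0.488T′`, root step `−0.3827T′ = sin(15π/8)T′` exactly.  The continuum agrees: `h = α∫(ψ′)^{3/8}` has root term `C w^{1/4}e^{−3πin/4}`,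
  whose real part → −∞ for `n = 1` — direction `1` does not rotate with the class, `ω = −e^{i(5/8)W_b}` does.  NOT hit: `HexHullStrict`
  (search: 245 polyhexes ≤ 5, 17 407 random simply connected domains ≤ 29 faces × 12 roots, boxes, steps — max angular gap 143.4° < 180°,
  always at the site whose hexagon contains the root vertex), r1 `HalfPlaneBounds` (i) (compacts avoid the root) and (ii)/(ii′) (`∃ ω`).
  REPAIR C′: register `HexHullStrict ∧ BoundaryHalfPlaneBounds.2` only — (ii′) with ONE `ω` over ALL boundary sites — and run
  `exists_boundarySite_re_le` in direction `ω`: gives (ii) verbatim and the ω-rotated (i); `stub_pickEngine` consumes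
  `Re(conj ω h_δ) + M ≥ 0` (near the gate direction `1` is right in every class since `h′ = αf`, `f > 0` on the gate; near the root only
  `ω` is).  The witness misses C′.
* (F8) SURVIVED (briefing in `survivors.md`): (E1)–(E4) true on paper (Alexander duality for exactness; Umlaufsatz on the pinch-free
  Jordan polygon ∂R(C) for (E3)/(E4); `e^{iW}` = last/first increment direction for (E2), residual 8e−12); `GateMassLaws` honours
  `Negative/FlatGateBudget` through `x ∉ closedBall y (2ρ′)` (load-bearing for the upper bound); `LocalL1Bound` is
  Banach–Steinhaus-necessary, no finsum junk; `PickCupLimits`/`Identification` consequents consistent (principal `(z−x)^{5/4}` continuous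
  on the upper half-disc, non-zero flat-point limits, `∃ g` pinned by the weak limit + holomorphy).
* (F9) FOR THE LEAD (positive lattice facts): the root wedge (ii) holds AT LATTICE SCALE inside the continuum π/4-sector — the
  leading-order direction set `−i + (2/(ℓS_∞))e^{i5π/8}(H(s) − H(s_a⁻))`, `S_∞ = 1/(2 sin(π/8))`, has `arg/π ∈ [−0.500, −0.250]` at all
  16 sites within 2.6 lattice units of the root (boxes up to 7×3, converged to 4 digits); the exact form `M = 0` of Claim D fails on
  down-steps by a bounded amount (−0.013 … −0.027 at 28–44 faces), as the lead found independently.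
-/

/-- Class `W_b = π` (normaliser west of the root along a flat or convex arc — the census class): the root step of `Re h_δ`
has the POSITIVE coefficient `sin(5π/8)`. [folklore] -/
theorem rootStep_coeff_pos_class_pi : 0 < Real.sin (5 / 8 * Real.pi) :=
  Real.sin_pos_of_pos_of_lt_pi (by positivity) (by nlinarith [Real.pi_pos])

/-- Class `W_b = 3π` (one clockwise curl of `∂Ω` between the gate and the root piece): the root step of `Re h_δ` has the
NEGATIVE coefficient `sin((5/8)·3π) = sin(15π/8) = −sin(π/8)` — the east root site lies `sin(π/8)·T′` BELOW the west one.
[folklore] -/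
theorem rootStep_coeff_neg_class_three_pi : Real.sin (5 / 8 * (3 * Real.pi)) < 0 := by
  have h : 5 / 8 * (3 * Real.pi) = 2 * Real.pi - Real.pi / 8 := by ring
  rw [h, Real.sin_two_pi_sub, neg_lt_zero]
  exact Real.sin_pos_of_pos_of_lt_pi (by positivity) (by nlinarith [Real.pi_pos])

/-- Class `W_b = 3π`: moving EAST along the root's west floor arm towards the root (`W_e = +π` by (E4)), each boundary edge
changes `Re h_δ` by `−sin((3/8)π + (5/8)·3π)·Z(e)·T′ = −sin(π/4)·Z(e)·T′ < 0` — the west arm DESCENDS into the root, by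
`(√2/2)·S_W·T′ → ∞` in total. [folklore] -/
theorem westArmStep_coeff_neg_class_three_pi :
    -Real.sin (3 / 8 * Real.pi + 5 / 8 * (3 * Real.pi)) < 0 := by
  have h : 3 / 8 * Real.pi + 5 / 8 * (3 * Real.pi) = Real.pi / 4 + 2 * Real.pi := by ring
  rw [h, Real.sin_add_two_pi, neg_lt_zero]
  exact Real.sin_pos_of_pos_of_lt_pi (by positivity) (by nlinarith [Real.pi_pos])

/-- Class `W_b = 3π`: moving east along the root's EAST arm away from the root (`W_e = −π`), each edge changes `Re h_δ` by
`−sin(−(3/8)π + (5/8)·3π)·Z(e)·T′ = +Z(e)·T′` — `Re h_δ` recovers only AFTER the root, consistent with the boundary closure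
`−sin(π/4)S − sin(π/8) + S = 0` at `S = 1/(2 sin(π/8))`. [folklore] -/
theorem eastArmStep_coeff_pos_class_three_pi :
    0 < -Real.sin (-(3 / 8 * Real.pi) + 5 / 8 * (3 * Real.pi)) := by
  have h : -(3 / 8 * Real.pi) + 5 / 8 * (3 * Real.pi) = Real.pi / 2 + Real.pi := by ring
  rw [h, Real.sin_add_pi, Real.sin_pi_div_two]
  norm_num

/-- The closure identity of the class-`3π` coefficients at the half-plane arm mass `S = 1/(2 sin(π/8))`:
`−sin(π/4)·S − sin(π/8) + 1·S = 0`, i.e. `S·(1 − sin(π/4)) = sin(π/8)` — equivalently `2 sin(π/8)(1 − √2/2) = 2 sin²(π/8)`…;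
recorded in the elementary form `(1 − sin(π/4)) = 2 sin(π/8)²` (since `sin(π/4) = cos(2·π/8) = 1 − 2 sin²(π/8)`). [folklore] -/
theorem closure_class_three_pi : 1 - Real.sin (Real.pi / 4) = 2 * Real.sin (Real.pi / 8) ^ 2 := by
  have h : Real.sin (Real.pi / 4) = Real.cos (2 * (Real.pi / 8)) := by
    rw [← Real.cos_pi_div_two_sub]; congr 1; ring
  rw [h, Real.cos_two_mul, Real.cos_sq']
  ring

end Summit.CriticalPhenomena.SAWScalingLimit.Cruxes.BoundaryClosureR.Disproof

end
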